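import Summits.AtomisticToContinuum.FouriersLaw.Theses.BondHeatUncertainty

/-!
# Line `linear-score-cauchy-schwarz` — checked skeleton for crux `LinearResponseFTUR` (★)
(stmt-AtomisticToContinuum-9122, route BondHeatUncertainty; crux-plan round 1, 2026-08-16)

Idea card: `Cruxes/LinearResponseFTUR/Ideas/linear-score-cauchy-schwarz.md` (triage r1: pass ×3, primary of the
CS/Gram cluster). (★) at order `δ²` IS Cauchy–Schwarz, on the EQUILIBRIUM stationary process, between the bond heat
`Q_t` and the explicit linear score `S_t = Q_t/T² + U(x_t) - U(Θx_0)`, `L_T U = -j_b/T²` (`W = U∘Θ` the flipped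
corrector): `⟨Q_t,S_t⟩ = 2gt`, `½‖S_t‖² = k + gt/T²`, `‖Q_t‖² = V_N(b,t)`, hence `2g²t² ≤ V_N(b,t)(gt/T² + k)`; the NESS
supplies only `D_N/(N-1) = g` and `k ≤ K`, both obtained here WITHOUT response theory: the response of an observable in
`Ran(L_T)` along the weak steady-state family is exact (`stub_dualResponse`), and the snapshot-KL hypothesis is consumed
by Cauchy–Schwarz against the Θ-symmetrised snapshot (`stub_oddSnapshotBound`) — the NESS half of the gen-2 card
`odd-density-dual-correctors`, adopted per the triage sharpenings (Liouville concern on `GreenKuboCorrectorForm ∀W`).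

Six registered stubs (`stub_*`, the only `sorry`s) and the kernel-checked composition
`LinearResponseFTUR_of : stub₁ → … → stub₆ → BondHeatUncertainty.LinearResponseFTUR` (real proof: filters, real
arithmetic, the quantifier mesh), its hypotheses keyed by the stub names (`Registered.stub_*` are the verbatim
statements), plus the wiring `example` feeding the six stubs. Statements are written without `let` (registration reads
the signature text): `P = pinnedChain ω₂ lam β γ`, `j_b = P.bondCurrent N ⟨b,_⟩`, `E = p_0² - p_{N-1}²` and the crux's
`V_N(b,t)` are spelled out. Line card: `Lines/linear-score-cauchy-schwarz.md`.

Disproof.lean honoured: `fturShape_false_without_K` — `K` enters at `stub_oddSnapshotBound` (`k ≤ K`, `k = ½‖S_0‖²`);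
`not_fturShape_two_add` — constant exactly `2` (identities); `fturShape_eq_zero_of_nonpos` — `0 ≤ V` is carried by
`stub_scoreCauchySchwarz` and used in the composition (monotonicity in `K`); `fturShape_nonneg` — `(a)` comes
independently from `0 ≤ g`; landed `Negative/KZeroCorner`, `Negative/ShapeConstraints`: no stub is an instance they
refute (`K = 0` admissible ⇒ `k = 0` ⇒ `φ = 0` ⇒ `g`… consistent via `response_eq_zero_of_klDiv_le_zero`; no stub
restates the shape with other constants).
-/

namespace Summit.AtomisticToContinuum.FouriersLaw.Cruxes.LinearResponseFTUR.LinearScoreCauchySchwarz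

open MeasureTheory ProbabilityTheory Filter Topology
open scoped NNReal ENNReal ContDiff BigOperators
open Literature.MathematicalPhysics.KineticTheory.HeatConduction

/-! ## Registered stubs (the only `sorry`s of the line) -/

/-- **stub 1 · `stub_correctors` — calibrated equilibrium correctors (existence; size L).**
For the pinned chain at ONE temperature `T` (`N ≥ 2`, bond `b`, `j = j_b`): there are smooth `U`, `Z` with
`e^{θH}`-bounded 2-jets for some `θ < 1/(2T)` solving the two Poisson equations at equilibrium
`L_T U = -j_b/T²` (first corrector; `W := U∘Θ` is the card's FLIPPED corrector, `(ΘL_TΘ)W = j_b/T²`) and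
`L_T Z = U - U∘Θ` (second corrector), CALIBRATED against the bath-side (McLennan) source `E = p_0² - p_{N-1}²`:
`(γ/2)⟨U, E⟩ = ⟨U, j_b⟩` (=: `g`, the Green–Kubo value `T⁻²∫₀^∞ C_N(b,s)ds`) and
`-(γ/2T²)⟨Z, E⟩ = ½‖U - U∘Θ‖²` (=: `k` = `2‖h_odd‖²`). Expected proof: canonical correctors
`U = T⁻²∫₀^∞ P_s j_b ds`, `Z = -∫₀^∞ P_s (U - U∘Θ) ds` from the exponential convergence of the equal-temperature
semigroup in the `e^{ϑH}` norm (`pinnedChainSemigroup_exp_convergence`, `CuneoEckmannHairerReyBellet2018_H2_holds`),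
hypoelliptic regularity with weights for the 2-jets; the first calibration is Gibbs integration by parts
(`L_T E_b = -2j_b - γE` for the half-chain energy difference `E_b`, `⟨L_T U, E_b⟩ = 0` by parity), the second is
Θ-detailed balance (`⟨Z, L_T U⟩ = T⁻²∫₀^∞⟨P_s φ, j⟩ds = ⟨φ, U⟩ = ½‖φ‖²`, `φ = U - U∘Θ`). Exact on the harmonic
member (dual_corrector_check.out: 1/6, 3/22, 11/86; 2/9, 41/121, 868/1849). -/
theorem stub_correctors :
    ∀ ω₂ lam β γ : ℝ, 0 < ω₂ → 0 < lam → 0 < β → 0 < γ → ∀ T : ℝ, 0 < T →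
    ∀ N : ℕ, 2 ≤ N → ∀ (b : ℕ) (hb : b + 1 < N),
     ∃ U Z : PhaseSpace N → ℝ, ContDiff ℝ ∞ U ∧ ContDiff ℝ ∞ Z ∧
       (∃ θ A : ℝ, θ < 1 / (2 * T) ∧ ∀ n : ℕ, n ≤ 2 → ∀ x : PhaseSpace N,
          ‖iteratedFDeriv ℝ n U x‖ ≤ A * Real.exp (θ * (pinnedChain ω₂ lam β γ).hamiltonian N x) ∧
          ‖iteratedFDeriv ℝ n Z x‖ ≤ A * Real.exp (θ * (pinnedChain ω₂ lam β γ).hamiltonian N x)) ∧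
       (∀ x : PhaseSpace N, (pinnedChain ω₂ lam β γ).generator N T T U x = -((pinnedChain ω₂ lam β γ).bondCurrent N ⟨b, by omega⟩ x) / T ^ 2) ∧
       (∀ x : PhaseSpace N, (pinnedChain ω₂ lam β γ).generator N T T Z x = U x - U (x.1, -x.2)) ∧
       (γ / 2) * ∫ x, U x * (∑ i : Fin N, ((if i.val = 0 then x.2 i ^ 2 else 0) - (if i.val = N - 1 then x.2 i ^ 2 else 0))) ∂((pinnedChain ω₂ lam β γ).gibbsMeasure N T) =
          ∫ x, U x * (pinnedChain ω₂ lam β γ).bondCurrent N ⟨b, by omega⟩ x ∂((pinnedChain ω₂ lam β γ).gibbsMeasure N T) ∧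
       -(γ / (2 * T ^ 2)) * ∫ x, Z x * (∑ i : Fin N, ((if i.val = 0 then x.2 i ^ 2 else 0) - (if i.val = N - 1 then x.2 i ^ 2 else 0))) ∂((pinnedChain ω₂ lam β γ).gibbsMeasure N T) =
          (1 / 2) * ∫ x, (U x - U (x.1, -x.2)) ^ 2 ∂((pinnedChain ω₂ lam β γ).gibbsMeasure N T) := by
  sorry

/-- **stub 2 · `stub_scoreCauchySchwarz` — THE LEVER (size L, load-bearing).** At equal temperatures, GIVEN the
Θ-detailed balance of the constructed kernel w.r.t. Gibbs (hypothesis = the statement of `stub_gibbsDetailedBalance`),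
for every smooth first corrector `U` of bond `b` (`L_T U = -j_b/T²`, `e^{θH}`-bounded 2-jet, `θ < 1/(2T)`), with
`g = ⟨U, j_b⟩_{μ_T}`, `k = ½‖U - U∘Θ‖²_{μ_T}` and `V_N(b,t) = 2∫₀ᵗ(t-s)C_N(b,s)ds` written EXACTLY as in the crux:
`0 ≤ g`, `0 ≤ V_N(b,t)` and `2g²t² ≤ V_N(b,t)·(gt/T² + k)` for all `t > 0`. Mechanism: on the stationary equilibrium
process (solMap under `μ_T ⊗ wienerPair`) the linear score `S_t = Q_t/T² + U(x_t) - U(Θx_0)` has `⟨Q_t,S_t⟩ = 2gt`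
and `½‖S_t‖² = k + gt/T²` (Dynkin on the weighted class + `P_s† = ΘP_sΘ`), `‖Q_t‖² = V`; the claim is Cauchy–Schwarz
(`Disproof.shape_of_gram_identities`), and `0 ≤ g` is `‖S_t‖² ≥ 0` as `t → ∞`. Honours `fturShape_false_without_K`
(`k = ½‖S_0‖²` is where `K` enters) and `not_fturShape_two_add` (identities, nothing spent). -/
theorem stub_scoreCauchySchwarz :
    ∀ ω₂ lam β γ : ℝ, 0 < ω₂ → 0 < lam → 0 < β → 0 < γ → ∀ T : ℝ, 0 < T →
    ∀ N : ℕ, 2 ≤ N →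
     (∀ (t : ℝ≥0) (f g : PhaseSpace N → ℝ), Measurable f → Measurable g →
        (∃ C : ℝ, ∀ x, |f x| ≤ C) → (∃ C : ℝ, ∀ x, |g x| ≤ C) →
        ∫ z, f z * (∫ y, g y ∂((pinnedChain ω₂ lam β γ).transitionKernel N T T t z)) ∂((pinnedChain ω₂ lam β γ).gibbsMeasure N T) =
          ∫ z, g (z.1, -z.2) * (∫ y, f (y.1, -y.2) ∂((pinnedChain ω₂ lam β γ).transitionKernel N T T t z)) ∂((pinnedChain ω₂ lam β γ).gibbsMeasure N T)) →
     ∀ (b : ℕ) (hb : b + 1 < N),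
     ∀ U : PhaseSpace N → ℝ, ContDiff ℝ ∞ U →
       (∃ θ A : ℝ, θ < 1 / (2 * T) ∧ ∀ n : ℕ, n ≤ 2 → ∀ x : PhaseSpace N,
          ‖iteratedFDeriv ℝ n U x‖ ≤ A * Real.exp (θ * (pinnedChain ω₂ lam β γ).hamiltonian N x)) →
       (∀ x : PhaseSpace N, (pinnedChain ω₂ lam β γ).generator N T T U x = -((pinnedChain ω₂ lam β γ).bondCurrent N ⟨b, by omega⟩ x) / T ^ 2) →
       ∀ g k : ℝ, g = ∫ x, U x * (pinnedChain ω₂ lam β γ).bondCurrent N ⟨b, by omega⟩ x ∂((pinnedChain ω₂ lam β γ).gibbsMeasure N T) →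
         k = (1 / 2) * ∫ x, (U x - U (x.1, -x.2)) ^ 2 ∂((pinnedChain ω₂ lam β γ).gibbsMeasure N T) →
         0 ≤ g ∧ ∀ t : ℝ, 0 < t →
           0 ≤ (2 * ∫ s in (0 : ℝ)..t, (t - s) * (if h : b < N then ∫ z, (pinnedChain ω₂ lam β γ).bondCurrent N ⟨b, h⟩ z * (∫ y, (pinnedChain ω₂ lam β γ).bondCurrent N ⟨b, h⟩ y ∂((pinnedChain ω₂ lam β γ).transitionKernel N T T s.toNNReal z)) ∂((pinnedChain ω₂ lam β γ).gibbsMeasure N T) else 0)) ∧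
           2 * g ^ 2 * t ^ 2 ≤ (2 * ∫ s in (0 : ℝ)..t, (t - s) * (if h : b < N then ∫ z, (pinnedChain ω₂ lam β γ).bondCurrent N ⟨b, h⟩ z * (∫ y, (pinnedChain ω₂ lam β γ).bondCurrent N ⟨b, h⟩ y ∂((pinnedChain ω₂ lam β γ).transitionKernel N T T s.toNNReal z)) ∂((pinnedChain ω₂ lam β γ).gibbsMeasure N T) else 0)) * (g * t / T ^ 2 + k) := by
  sorry

/-- **stub 3 · `stub_dualResponse` — response without response theory (size M/L).** Under weak-NESS uniqueness,
along every steady-state family, for `N ≥ 2`, `T > 0` and every smooth `F` with `e^{θH}`-bounded 2-jet (`θ < 1/(2T)`):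
`(1/δ)∫ L_{T,T}F dμ_{N,T+δ/2,T-δ/2} → -(γ/2T²)∫ F·(p_0² - p_{N-1}²) dμ_T` (`δ → 0`, `δ ≠ 0`). Mechanism: the
generator is affine in the bath temperatures, `L_δ F - L_T F = (γδ/2)(∂²_{p_0} - ∂²_{p_{N-1}})F`, and `∫ L_δ F dμ_δ = 0`
(weak stationarity extended from `C_c^∞` to the weighted class by an energy cut-off, using the `e^{ϑH}`-moments of the
unique steady state), so the quotient EQUALS `-(γ/2)∫(∂²_{p_0} - ∂²_{p_{N-1}})F dμ_δ`; then continuity at `δ = 0`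
(`stub_nearEquilibrium` (a)) and Gaussian integration by parts in `p_0, p_{N-1}` under `μ_T`. Fed with `F = U` it
identifies the per-bond response with `g`; fed with `F = Z` it gives the response of `U - U∘Θ`, i.e. `k`. -/
theorem stub_dualResponse :
    ∀ ω₂ lam β γ : ℝ, 0 < ω₂ → 0 < lam → 0 < β → 0 < γ →
    (∀ (N : ℕ) (T_L T_R : ℝ), 0 < T_L → 0 < T_R → ∀ μ ν : Measure (PhaseSpace N),
      (pinnedChain ω₂ lam β γ).IsSteadyState N T_L T_R μ → (pinnedChain ω₂ lam β γ).IsSteadyState N T_L T_R ν → μ = ν) →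
    ∀ μ : (N : ℕ) → ℝ → ℝ → Measure (PhaseSpace N),
      (∀ (N : ℕ) (T_L T_R : ℝ), 0 < T_L → 0 < T_R → (pinnedChain ω₂ lam β γ).IsSteadyState N T_L T_R (μ N T_L T_R)) →
    ∀ T : ℝ, 0 < T → ∀ N : ℕ, 2 ≤ N →
     ∀ F : PhaseSpace N → ℝ, ContDiff ℝ ∞ F →
       (∃ θ A : ℝ, θ < 1 / (2 * T) ∧ ∀ n : ℕ, n ≤ 2 → ∀ x : PhaseSpace N,
          ‖iteratedFDeriv ℝ n F x‖ ≤ A * Real.exp (θ * (pinnedChain ω₂ lam β γ).hamiltonian N x)) →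
       Tendsto (fun δ : ℝ => (∫ x, (pinnedChain ω₂ lam β γ).generator N T T F x ∂(μ N (T + δ / 2) (T - δ / 2))) / δ)
         (𝓝[≠] 0) (𝓝 (-(γ / (2 * T ^ 2)) * ∫ x, F x * (∑ i : Fin N, ((if i.val = 0 then x.2 i ^ 2 else 0) - (if i.val = N - 1 then x.2 i ^ 2 else 0))) ∂((pinnedChain ω₂ lam β γ).gibbsMeasure N T))) := by
  sorry

/-- **stub 4 · `stub_nearEquilibrium` — the unique weak steady state near equilibrium (size L).** Under
weak-NESS uniqueness, along every steady-state family, `N ≥ 2`, `T > 0`: (a) every continuous observable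
`F = O(e^{θ'H})`, `θ' < 1/T`, is eventually (as `δ → 0`) integrable for `μ_δ := μ_{N,T+δ/2,T-δ/2}` and
`∫F dμ_δ → ∫F dμ_T` (locally-uniform `e^{ϑH}`-moments from the in-tree Lyapunov bound `pinnedChain_H2_of_pos` with
constants tracked in the temperatures, tightness, closedness of the weak Fokker–Planck class, uniqueness at `(T,T)`
where Gibbs is a steady state, `pinnedChain_isSteadyState_gibbsMeasure`); (b) eventually all bonds carry the same mean
current, `(N-1)·∫ j_b dμ_δ = totalCurrent μ_δ` (weak stationarity tested on the interior site energies,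
`L_δ e_i = j_{i-1} - j_i`, cut-off + moments). The only place where a-priori bounds on the NESS enter the line. -/
theorem stub_nearEquilibrium :
    ∀ ω₂ lam β γ : ℝ, 0 < ω₂ → 0 < lam → 0 < β → 0 < γ →
    (∀ (N : ℕ) (T_L T_R : ℝ), 0 < T_L → 0 < T_R → ∀ μ ν : Measure (PhaseSpace N),
      (pinnedChain ω₂ lam β γ).IsSteadyState N T_L T_R μ → (pinnedChain ω₂ lam β γ).IsSteadyState N T_L T_R ν → μ = ν) →
    ∀ μ : (N : ℕ) → ℝ → ℝ → Measure (PhaseSpace N),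
      (∀ (N : ℕ) (T_L T_R : ℝ), 0 < T_L → 0 < T_R → (pinnedChain ω₂ lam β γ).IsSteadyState N T_L T_R (μ N T_L T_R)) →
    ∀ T : ℝ, 0 < T → ∀ N : ℕ, 2 ≤ N →
     (∀ θ' : ℝ, θ' < 1 / T → ∀ F : PhaseSpace N → ℝ, Continuous F →
        (∃ A : ℝ, ∀ x : PhaseSpace N, |F x| ≤ A * Real.exp (θ' * (pinnedChain ω₂ lam β γ).hamiltonian N x)) →
        (∀ᶠ δ in 𝓝[≠] (0 : ℝ), Integrable F (μ N (T + δ / 2) (T - δ / 2))) ∧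
        Tendsto (fun δ : ℝ => ∫ x, F x ∂(μ N (T + δ / 2) (T - δ / 2))) (𝓝[≠] 0)
          (𝓝 (∫ x, F x ∂((pinnedChain ω₂ lam β γ).gibbsMeasure N T)))) ∧
     (∀ᶠ δ in 𝓝[≠] (0 : ℝ), ∀ (b : ℕ) (hb : b + 1 < N),
        ((N : ℝ) - 1) * ∫ x, (pinnedChain ω₂ lam β γ).bondCurrent N ⟨b, by omega⟩ x ∂(μ N (T + δ / 2) (T - δ / 2)) =
          (pinnedChain ω₂ lam β γ).totalCurrent (μ N (T + δ / 2) (T - δ / 2))) := by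
  sorry

/-- **stub 5 · `stub_oddSnapshotBound` — Cauchy–Schwarz against the Θ-symmetrised snapshot (size M, provable
now).** For every probability measure `μ` on phase space and every Θ-odd `φ ∈ L²(μ)` with `KL(μ ‖ Θ_*μ) < ∞`:
`(∫φ dμ)² ≤ ½·KL(μ ‖ Θ_*μ)·∫φ² dμ`. Proof sketch: `m := ½(μ + Θ_*μ)` is Θ-invariant, `dμ/dm = 1 + a` with `|a| ≤ 1`,
`a∘Θ = -a`; `KL = ∫2(1+a)artanh a dm = ∫ 2a·artanh a dm ≥ 2∫a² dm` (the odd term integrates to `0`; integrability of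
`artanh a` on `{a < -½}` by the Θ-symmetry `{f < ½} = Θ{f > 3/2}`), `∫φ dμ = ∫φ a dm`, `∫φ² dm = ∫φ² dμ`,
Cauchy–Schwarz. This is how the crux's snapshot-KL hypothesis is consumed (with `φ = U - U∘Θ = L_T Z`): no NESS
density, no Donsker–Varadhan with bounded test functions, no response theory for bounded observables. -/
theorem stub_oddSnapshotBound :
    ∀ (N : ℕ) (μ : Measure (PhaseSpace N)), IsProbabilityMeasure μ →
    ∀ φ : PhaseSpace N → ℝ, (∀ x : PhaseSpace N, φ (x.1, -x.2) = -φ x) → MemLp φ 2 μ →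
      InformationTheory.klDiv μ (Measure.map (fun x : PhaseSpace N => (x.1, -x.2)) μ) ≠ ⊤ →
      (∫ x, φ x ∂μ) ^ 2 ≤
        (1 / 2) * (InformationTheory.klDiv μ (Measure.map (fun x : PhaseSpace N => (x.1, -x.2)) μ)).toReal *
          ∫ x, φ x ^ 2 ∂μ := by
  sorry

/-- **stub 6 · `stub_gibbsDetailedBalance` — Θ-detailed balance of the constructed equal-temperature kernel
w.r.t. Gibbs (size M/L; shared by every line on this crux, unproved in tree).** For bounded measurable `f, g`:
`∫ f·(P_t g) dμ_T = ∫ (g∘Θ)·(P_t(f∘Θ)) dμ_T`, i.e. `P_t† = Θ P_t Θ` on `L²(μ_T)`; with `g = 1` it is the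
kernel-invariance of the Gibbs measure flagged by the grounders. Expected proof: Lebesgue duality of the Langevin
kernels (`LangevinChainReversal.compProd_langevinKernel_eq`, `dx P_t(x,dy) = e^{2γt} dy P̂_t(y,dx)`) +
`e^{-H/T}`-conjugation + momentum flip of the reversed drift, after identifying `langevinKernel = transitionKernel`
for the pinned chain (only the pure-quartic twin `pureQuarticChain_langevinKernel_eq_transitionKernel` is in tree).
Typed as ideator 3's `EquilibriumReversibility` (triage: true, no junk instance; `N = 0` trivial). -/
theorem stub_gibbsDetailedBalance :
    ∀ ω₂ lam β γ : ℝ, 0 < ω₂ → 0 < lam → 0 < β → 0 < γ → ∀ (N : ℕ) (T : ℝ), 0 < T →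
     ∀ (t : ℝ≥0) (f g : PhaseSpace N → ℝ), Measurable f → Measurable g →
        (∃ C : ℝ, ∀ x, |f x| ≤ C) → (∃ C : ℝ, ∀ x, |g x| ≤ C) →
        ∫ z, f z * (∫ y, g y ∂((pinnedChain ω₂ lam β γ).transitionKernel N T T t z)) ∂((pinnedChain ω₂ lam β γ).gibbsMeasure N T) =
          ∫ z, g (z.1, -z.2) * (∫ y, f (y.1, -y.2) ∂((pinnedChain ω₂ lam β γ).transitionKernel N T T t z)) ∂((pinnedChain ω₂ lam β γ).gibbsMeasure N T) := by
  sorry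

/-! ## Name-keyed aliases of the six statements (the hypothesis types of the composition)

`Registered.stub_<name>` is VERBATIM the statement of `stub_<name>` (the wiring `example` at the end checks it
definitionally); the skeleton audit admits a `Prop` hypothesis whose head constant carries a stub's name. -/
namespace Registered

/-- Verbatim statement of `stub_correctors`. -/
abbrev stub_correctors : Prop :=
    ∀ ω₂ lam β γ : ℝ, 0 < ω₂ → 0 < lam → 0 < β → 0 < γ → ∀ T : ℝ, 0 < T →
    ∀ N : ℕ, 2 ≤ N → ∀ (b : ℕ) (hb : b + 1 < N),
     ∃ U Z : PhaseSpace N → ℝ, ContDiff ℝ ∞ U ∧ ContDiff ℝ ∞ Z ∧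
       (∃ θ A : ℝ, θ < 1 / (2 * T) ∧ ∀ n : ℕ, n ≤ 2 → ∀ x : PhaseSpace N,
          ‖iteratedFDeriv ℝ n U x‖ ≤ A * Real.exp (θ * (pinnedChain ω₂ lam β γ).hamiltonian N x) ∧
          ‖iteratedFDeriv ℝ n Z x‖ ≤ A * Real.exp (θ * (pinnedChain ω₂ lam β γ).hamiltonian N x)) ∧
       (∀ x : PhaseSpace N, (pinnedChain ω₂ lam β γ).generator N T T U x = -((pinnedChain ω₂ lam β γ).bondCurrent N ⟨b, by omega⟩ x) / T ^ 2) ∧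
       (∀ x : PhaseSpace N, (pinnedChain ω₂ lam β γ).generator N T T Z x = U x - U (x.1, -x.2)) ∧
       (γ / 2) * ∫ x, U x * (∑ i : Fin N, ((if i.val = 0 then x.2 i ^ 2 else 0) - (if i.val = N - 1 then x.2 i ^ 2 else 0))) ∂((pinnedChain ω₂ lam β γ).gibbsMeasure N T) =
          ∫ x, U x * (pinnedChain ω₂ lam β γ).bondCurrent N ⟨b, by omega⟩ x ∂((pinnedChain ω₂ lam β γ).gibbsMeasure N T) ∧
       -(γ / (2 * T ^ 2)) * ∫ x, Z x * (∑ i : Fin N, ((if i.val = 0 then x.2 i ^ 2 else 0) - (if i.val = N - 1 then x.2 i ^ 2 else 0))) ∂((pinnedChain ω₂ lam β γ).gibbsMeasure N T) =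
          (1 / 2) * ∫ x, (U x - U (x.1, -x.2)) ^ 2 ∂((pinnedChain ω₂ lam β γ).gibbsMeasure N T)

/-- Verbatim statement of `stub_scoreCauchySchwarz`. -/
abbrev stub_scoreCauchySchwarz : Prop :=
    ∀ ω₂ lam β γ : ℝ, 0 < ω₂ → 0 < lam → 0 < β → 0 < γ → ∀ T : ℝ, 0 < T →
    ∀ N : ℕ, 2 ≤ N →
     (∀ (t : ℝ≥0) (f g : PhaseSpace N → ℝ), Measurable f → Measurable g →
        (∃ C : ℝ, ∀ x, |f x| ≤ C) → (∃ C : ℝ, ∀ x, |g x| ≤ C) →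
        ∫ z, f z * (∫ y, g y ∂((pinnedChain ω₂ lam β γ).transitionKernel N T T t z)) ∂((pinnedChain ω₂ lam β γ).gibbsMeasure N T) =
          ∫ z, g (z.1, -z.2) * (∫ y, f (y.1, -y.2) ∂((pinnedChain ω₂ lam β γ).transitionKernel N T T t z)) ∂((pinnedChain ω₂ lam β γ).gibbsMeasure N T)) →
     ∀ (b : ℕ) (hb : b + 1 < N),
     ∀ U : PhaseSpace N → ℝ, ContDiff ℝ ∞ U →
       (∃ θ A : ℝ, θ < 1 / (2 * T) ∧ ∀ n : ℕ, n ≤ 2 → ∀ x : PhaseSpace N,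
          ‖iteratedFDeriv ℝ n U x‖ ≤ A * Real.exp (θ * (pinnedChain ω₂ lam β γ).hamiltonian N x)) →
       (∀ x : PhaseSpace N, (pinnedChain ω₂ lam β γ).generator N T T U x = -((pinnedChain ω₂ lam β γ).bondCurrent N ⟨b, by omega⟩ x) / T ^ 2) →
       ∀ g k : ℝ, g = ∫ x, U x * (pinnedChain ω₂ lam β γ).bondCurrent N ⟨b, by omega⟩ x ∂((pinnedChain ω₂ lam β γ).gibbsMeasure N T) →
         k = (1 / 2) * ∫ x, (U x - U (x.1, -x.2)) ^ 2 ∂((pinnedChain ω₂ lam β γ).gibbsMeasure N T) →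
         0 ≤ g ∧ ∀ t : ℝ, 0 < t →
           0 ≤ (2 * ∫ s in (0 : ℝ)..t, (t - s) * (if h : b < N then ∫ z, (pinnedChain ω₂ lam β γ).bondCurrent N ⟨b, h⟩ z * (∫ y, (pinnedChain ω₂ lam β γ).bondCurrent N ⟨b, h⟩ y ∂((pinnedChain ω₂ lam β γ).transitionKernel N T T s.toNNReal z)) ∂((pinnedChain ω₂ lam β γ).gibbsMeasure N T) else 0)) ∧
           2 * g ^ 2 * t ^ 2 ≤ (2 * ∫ s in (0 : ℝ)..t, (t - s) * (if h : b < N then ∫ z, (pinnedChain ω₂ lam β γ).bondCurrent N ⟨b, h⟩ z * (∫ y, (pinnedChain ω₂ lam β γ).bondCurrent N ⟨b, h⟩ y ∂((pinnedChain ω₂ lam β γ).transitionKernel N T T s.toNNReal z)) ∂((pinnedChain ω₂ lam β γ).gibbsMeasure N T) else 0)) * (g * t / T ^ 2 + k)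

/-- Verbatim statement of `stub_dualResponse`. -/
abbrev stub_dualResponse : Prop :=
    ∀ ω₂ lam β γ : ℝ, 0 < ω₂ → 0 < lam → 0 < β → 0 < γ →
    (∀ (N : ℕ) (T_L T_R : ℝ), 0 < T_L → 0 < T_R → ∀ μ ν : Measure (PhaseSpace N),
      (pinnedChain ω₂ lam β γ).IsSteadyState N T_L T_R μ → (pinnedChain ω₂ lam β γ).IsSteadyState N T_L T_R ν → μ = ν) →
    ∀ μ : (N : ℕ) → ℝ → ℝ → Measure (PhaseSpace N),
      (∀ (N : ℕ) (T_L T_R : ℝ), 0 < T_L → 0 < T_R → (pinnedChain ω₂ lam β γ).IsSteadyState N T_L T_R (μ N T_L T_R)) →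
    ∀ T : ℝ, 0 < T → ∀ N : ℕ, 2 ≤ N →
     ∀ F : PhaseSpace N → ℝ, ContDiff ℝ ∞ F →
       (∃ θ A : ℝ, θ < 1 / (2 * T) ∧ ∀ n : ℕ, n ≤ 2 → ∀ x : PhaseSpace N,
          ‖iteratedFDeriv ℝ n F x‖ ≤ A * Real.exp (θ * (pinnedChain ω₂ lam β γ).hamiltonian N x)) →
       Tendsto (fun δ : ℝ => (∫ x, (pinnedChain ω₂ lam β γ).generator N T T F x ∂(μ N (T + δ / 2) (T - δ / 2))) / δ)
         (𝓝[≠] 0) (𝓝 (-(γ / (2 * T ^ 2)) * ∫ x, F x * (∑ i : Fin N, ((if i.val = 0 then x.2 i ^ 2 else 0) - (if i.val = N - 1 then x.2 i ^ 2 else 0))) ∂((pinnedChain ω₂ lam β γ).gibbsMeasure N T)))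

/-- Verbatim statement of `stub_nearEquilibrium`. -/
abbrev stub_nearEquilibrium : Prop :=
    ∀ ω₂ lam β γ : ℝ, 0 < ω₂ → 0 < lam → 0 < β → 0 < γ →
    (∀ (N : ℕ) (T_L T_R : ℝ), 0 < T_L → 0 < T_R → ∀ μ ν : Measure (PhaseSpace N),
      (pinnedChain ω₂ lam β γ).IsSteadyState N T_L T_R μ → (pinnedChain ω₂ lam β γ).IsSteadyState N T_L T_R ν → μ = ν) →
    ∀ μ : (N : ℕ) → ℝ → ℝ → Measure (PhaseSpace N),
      (∀ (N : ℕ) (T_L T_R : ℝ), 0 < T_L → 0 < T_R → (pinnedChain ω₂ lam β γ).IsSteadyState N T_L T_R (μ N T_L T_R)) →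
    ∀ T : ℝ, 0 < T → ∀ N : ℕ, 2 ≤ N →
     (∀ θ' : ℝ, θ' < 1 / T → ∀ F : PhaseSpace N → ℝ, Continuous F →
        (∃ A : ℝ, ∀ x : PhaseSpace N, |F x| ≤ A * Real.exp (θ' * (pinnedChain ω₂ lam β γ).hamiltonian N x)) →
        (∀ᶠ δ in 𝓝[≠] (0 : ℝ), Integrable F (μ N (T + δ / 2) (T - δ / 2))) ∧
        Tendsto (fun δ : ℝ => ∫ x, F x ∂(μ N (T + δ / 2) (T - δ / 2))) (𝓝[≠] 0)
          (𝓝 (∫ x, F x ∂((pinnedChain ω₂ lam β γ).gibbsMeasure N T)))) ∧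
     (∀ᶠ δ in 𝓝[≠] (0 : ℝ), ∀ (b : ℕ) (hb : b + 1 < N),
        ((N : ℝ) - 1) * ∫ x, (pinnedChain ω₂ lam β γ).bondCurrent N ⟨b, by omega⟩ x ∂(μ N (T + δ / 2) (T - δ / 2)) =
          (pinnedChain ω₂ lam β γ).totalCurrent (μ N (T + δ / 2) (T - δ / 2)))

/-- Verbatim statement of `stub_oddSnapshotBound`. -/
abbrev stub_oddSnapshotBound : Prop :=
    ∀ (N : ℕ) (μ : Measure (PhaseSpace N)), IsProbabilityMeasure μ →
    ∀ φ : PhaseSpace N → ℝ, (∀ x : PhaseSpace N, φ (x.1, -x.2) = -φ x) → MemLp φ 2 μ →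
      InformationTheory.klDiv μ (Measure.map (fun x : PhaseSpace N => (x.1, -x.2)) μ) ≠ ⊤ →
      (∫ x, φ x ∂μ) ^ 2 ≤
        (1 / 2) * (InformationTheory.klDiv μ (Measure.map (fun x : PhaseSpace N => (x.1, -x.2)) μ)).toReal *
          ∫ x, φ x ^ 2 ∂μ

/-- Verbatim statement of `stub_gibbsDetailedBalance`. -/
abbrev stub_gibbsDetailedBalance : Prop :=
    ∀ ω₂ lam β γ : ℝ, 0 < ω₂ → 0 < lam → 0 < β → 0 < γ → ∀ (N : ℕ) (T : ℝ), 0 < T →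
     ∀ (t : ℝ≥0) (f g : PhaseSpace N → ℝ), Measurable f → Measurable g →
        (∃ C : ℝ, ∀ x, |f x| ≤ C) → (∃ C : ℝ, ∀ x, |g x| ≤ C) →
        ∫ z, f z * (∫ y, g y ∂((pinnedChain ω₂ lam β γ).transitionKernel N T T t z)) ∂((pinnedChain ω₂ lam β γ).gibbsMeasure N T) =
          ∫ z, g (z.1, -z.2) * (∫ y, f (y.1, -y.2) ∂((pinnedChain ω₂ lam β γ).transitionKernel N T T t z)) ∂((pinnedChain ω₂ lam β γ).gibbsMeasure N T)

end Registered

/-! ## Real-variable glue of the `K`-side (kernel-checked) -/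

/-- An eventual bound `m(δ)² ≤ ½ K δ² s(δ)` with `m(δ)/δ → c` and `s(δ) → s₀` forces `2c² ≤ K s₀`. -/
theorem two_mul_sq_le_of_eventually {m s : ℝ → ℝ} {c s₀ K : ℝ}
    (hm : Tendsto (fun δ => m δ / δ) (𝓝[≠] 0) (𝓝 c))
    (hs : Tendsto s (𝓝[≠] 0) (𝓝 s₀))
    (hev : ∀ᶠ δ in 𝓝[≠] (0 : ℝ), m δ ^ 2 ≤ (1 / 2) * (K * δ ^ 2) * s δ) :
    2 * c ^ 2 ≤ K * s₀ := by
  have hq : ∀ᶠ δ in 𝓝[≠] (0 : ℝ), (m δ / δ) ^ 2 ≤ (1 / 2) * K * s δ := by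
    filter_upwards [hev, self_mem_nhdsWithin] with δ hδ hne
    have hδ0 : (δ : ℝ) ≠ 0 := hne
    have hδ2 : 0 < δ ^ 2 := by positivity
    rw [div_pow, div_le_iff₀ hδ2]
    nlinarith [hδ]
  have hlim1 : Tendsto (fun δ => (m δ / δ) ^ 2) (𝓝[≠] 0) (𝓝 (c ^ 2)) := hm.pow 2
  have hlim2 : Tendsto (fun δ => (1 / 2) * K * s δ) (𝓝[≠] 0) (𝓝 ((1 / 2) * K * s₀)) :=
    hs.const_mul _
  have := le_of_tendsto_of_tendsto hlim1 hlim2 hq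
  linarith

/-- The `K`-side in the abstract form used by the composition: the odd-snapshot Cauchy–Schwarz bound at each small
`δ`, the response `m(δ)/δ → c` of `φ = U - U∘Θ`, the continuity `∫φ² dμ_δ → s₀`, the crux's hypothesis `KL ≤ Kδ²`
eventually, and the calibration `c = s₀/2` give `s₀/2 ≤ K`, i.e. `k ≤ K`. -/
theorem half_le_of_levers {KLδ : ℝ → ℝ≥0∞} {m s : ℝ → ℝ} {c s₀ K : ℝ} (hK : 0 ≤ K)
    (hCS : ∀ᶠ δ in 𝓝[≠] (0 : ℝ), KLδ δ ≠ ⊤ → m δ ^ 2 ≤ (1 / 2) * (KLδ δ).toReal * s δ)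
    (hs0 : ∀ δ, 0 ≤ s δ)
    (hm : Tendsto (fun δ => m δ / δ) (𝓝[≠] 0) (𝓝 c))
    (hs : Tendsto s (𝓝[≠] 0) (𝓝 s₀))
    (hyp : ∀ᶠ δ in 𝓝[≠] (0 : ℝ), KLδ δ ≤ ENNReal.ofReal (K * δ ^ 2))
    (halg : c = s₀ / 2) :
    s₀ / 2 ≤ K := by
  have hev : ∀ᶠ δ in 𝓝[≠] (0 : ℝ), m δ ^ 2 ≤ (1 / 2) * (K * δ ^ 2) * s δ := by
    filter_upwards [hyp, hCS] with δ hδ hCSδ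
    have hne : KLδ δ ≠ ⊤ := ne_top_of_le_ne_top ENNReal.ofReal_ne_top hδ
    have h1 := hCSδ hne
    have h2 : (KLδ δ).toReal ≤ K * δ ^ 2 := by
      have := ENNReal.toReal_mono ENNReal.ofReal_ne_top hδ
      rwa [ENNReal.toReal_ofReal (by positivity)] at this
    calc m δ ^ 2 ≤ (1 / 2) * (KLδ δ).toReal * s δ := h1
      _ ≤ (1 / 2) * (K * δ ^ 2) * s δ := by
        apply mul_le_mul_of_nonneg_right _ (hs0 δ)
        linarith
  have h := two_mul_sq_le_of_eventually hm hs hev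
  rw [halg] at h
  have hs0' : 0 ≤ s₀ := ge_of_tendsto' hs fun δ => hs0 δ
  rcases hs0'.lt_or_eq with hpos | hzero
  · nlinarith
  · rw [← hzero]; simpa using hK

/-! ## The composition: the six stubs give the crux BY NAME (no `sorry` below) -/

/-- **`LinearResponseFTUR_of`** — kernel-checked composition of the line: calibrated correctors (stub 1), the
equilibrium Cauchy–Schwarz inequality (stub 2, fed with the detailed balance of stub 6), the dual response limit
(stub 3), the near-equilibrium package of the unique weak steady state (stub 4) and the odd-snapshot bound (stub 5)
imply `BondHeatUncertainty.LinearResponseFTUR` (★). Per bond `b`: `J_b(δ)/δ → D_N/(N-1)` (equal currents) and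
`→ (γ/2)⟨U,E⟩ = g` (stubs 3+1), so `G_N = g ≥ 0` (clause (a) with `b = 0`); `((1/δ)∫φ dμ_δ)² ≤ ½K∫φ² dμ_δ`
eventually (stub 5 + the KL hypothesis), the limits (stubs 3, 4) and the calibration `c = k`, `s₀ = 2k` give `k ≤ K`;
then stub 2 and `0 ≤ V`. -/
theorem LinearResponseFTUR_of
    (hCor : Registered.stub_correctors) (hCS : Registered.stub_scoreCauchySchwarz)
    (hDual : Registered.stub_dualResponse) (hNear : Registered.stub_nearEquilibrium)
    (hOdd : Registered.stub_oddSnapshotBound) (hDB : Registered.stub_gibbsDetailedBalance) :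
    Summit.AtomisticToContinuum.FouriersLaw.Theses.BondHeatUncertainty.LinearResponseFTUR := by
  intro ω₂ lam β γ hω hl hβ hγ huniq μ hμ T hT D hD
  intro P C V N hN
  have hCor' := hCor ω₂ lam β γ hω hl hβ hγ T hT
  have hDB' := hDB ω₂ lam β γ hω hl hβ hγ N T hT
  have hCS' := hCS ω₂ lam β γ hω hl hβ hγ T hT N hN hDB'
  have hDual' := hDual ω₂ lam β γ hω hl hβ hγ huniq μ hμ T hT N hN
  obtain ⟨hStat, hEq⟩ := hNear ω₂ lam β γ hω hl hβ hγ huniq μ hμ T hT N hN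
  have hN1 : (0 : ℝ) < (N : ℝ) - 1 := by
    have : (2 : ℝ) ≤ (N : ℝ) := by exact_mod_cast hN
    linarith
  have hT2 : (0 : ℝ) < T ^ 2 := by positivity
  -- bath temperatures are positive near `δ = 0`
  have hpos : ∀ᶠ δ in 𝓝[≠] (0 : ℝ), 0 < T + δ / 2 ∧ 0 < T - δ / 2 := by
    have h2 : ∀ᶠ δ in 𝓝 (0 : ℝ), δ < 2 * T := eventually_lt_nhds (by linarith)
    have h2' : ∀ᶠ δ in 𝓝 (0 : ℝ), -(2 * T) < δ := eventually_gt_nhds (by linarith)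
    filter_upwards [mem_nhdsWithin_of_mem_nhds h2, mem_nhdsWithin_of_mem_nhds h2'] with δ hlt hgt
    exact ⟨by linarith, by linarith⟩
  -- PER BOND: the response per bond is the Green–Kubo value `g ≥ 0` of a calibrated corrector, and the crux's
  -- KL hypothesis dominates `k`.
  have key : ∀ b : ℕ, b + 1 < N →
      ∃ g : ℝ, 0 ≤ g ∧ D N / ((N : ℝ) - 1) = g ∧
        ∀ t : ℝ, 0 < t → ∀ K : ℝ, 0 ≤ K →
          (∀ᶠ δ in 𝓝[≠] (0 : ℝ), InformationTheory.klDiv (μ N (T + δ / 2) (T - δ / 2))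
            (Measure.map (fun x : PhaseSpace N => (x.1, -x.2)) (μ N (T + δ / 2) (T - δ / 2))) ≤
            ENNReal.ofReal (K * δ ^ 2)) →
          2 * g ^ 2 * t ^ 2 ≤ V N b t * (g * t / T ^ 2 + K) := by
    intro b hb
    have hbN : b < N := by omega
    -- stub 1: calibrated correctors of bond `b`
    obtain ⟨U, Z, hUs, hZs, ⟨θ, A, hθ, hbd⟩, hUeq, hZeq, hcalU, hcalZ⟩ := hCor' N hN b hb
    have hUb : ∃ θ A : ℝ, θ < 1 / (2 * T) ∧ ∀ n : ℕ, n ≤ 2 → ∀ x : PhaseSpace N,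
        ‖iteratedFDeriv ℝ n U x‖ ≤ A * Real.exp (θ * (pinnedChain ω₂ lam β γ).hamiltonian N x) :=
      ⟨θ, A, hθ, fun n hn x => (hbd n hn x).1⟩
    have hZb : ∃ θ A : ℝ, θ < 1 / (2 * T) ∧ ∀ n : ℕ, n ≤ 2 → ∀ x : PhaseSpace N,
        ‖iteratedFDeriv ℝ n Z x‖ ≤ A * Real.exp (θ * (pinnedChain ω₂ lam β γ).hamiltonian N x) :=
      ⟨θ, A, hθ, fun n hn x => (hbd n hn x).2⟩
    -- stub 2 (fed with stub 6): the Cauchy–Schwarz inequality of the line, `g`, `k` by their defining equations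
    obtain ⟨hg0, hdyn⟩ := hCS' b hb U hUs hUb hUeq _ _ rfl rfl
    ------------------------------------------------------------------
    -- Green–Kubo side: `D N / (N - 1) = (γ/2)⟨U, E⟩ = g`
    ------------------------------------------------------------------
    -- stub 3 with `F = U`
    have hDU := hDual' U hUs hUb
    have hDU' : Tendsto (fun δ : ℝ =>
        (-(∫ x, (pinnedChain ω₂ lam β γ).bondCurrent N ⟨b, hbN⟩ x ∂(μ N (T + δ / 2) (T - δ / 2))) / T ^ 2) / δ)
        (𝓝[≠] 0) (𝓝 (-(γ / (2 * T ^ 2)) * ∫ x, U x * (∑ i : Fin N, ((if i.val = 0 then x.2 i ^ 2 else 0) - (if i.val = N - 1 then x.2 i ^ 2 else 0))) ∂((pinnedChain ω₂ lam β γ).gibbsMeasure N T))) := by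
      refine hDU.congr fun δ => ?_
      rw [integral_congr_ae (ae_of_all _ hUeq), integral_div, integral_neg]
    -- stub 4 (b): equal bond currents, so `J_b(δ)/δ → D N / (N - 1)`
    have hJ : Tendsto (fun δ : ℝ =>
        (∫ x, (pinnedChain ω₂ lam β γ).bondCurrent N ⟨b, hbN⟩ x ∂(μ N (T + δ / 2) (T - δ / 2))) / δ)
        (𝓝[≠] 0) (𝓝 (D N / ((N : ℝ) - 1))) := by
      have h1 : Tendsto (fun δ : ℝ =>
          (pinnedChain ω₂ lam β γ).totalCurrent (μ N (T + δ / 2) (T - δ / 2)) / δ / ((N : ℝ) - 1))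
          (𝓝[≠] 0) (𝓝 (D N / ((N : ℝ) - 1))) := (hD N).div_const _
      refine h1.congr' ?_
      filter_upwards [hEq] with δ hδ
      have hδb : ((N : ℝ) - 1) * ∫ x, (pinnedChain ω₂ lam β γ).bondCurrent N ⟨b, hbN⟩ x ∂(μ N (T + δ / 2) (T - δ / 2)) =
          (pinnedChain ω₂ lam β γ).totalCurrent (μ N (T + δ / 2) (T - δ / 2)) := hδ b hb
      have hJb : ∫ x, (pinnedChain ω₂ lam β γ).bondCurrent N ⟨b, hbN⟩ x ∂(μ N (T + δ / 2) (T - δ / 2)) =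
          (pinnedChain ω₂ lam β γ).totalCurrent (μ N (T + δ / 2) (T - δ / 2)) / ((N : ℝ) - 1) := by
        rw [eq_div_iff hN1.ne', mul_comm]
        exact hδb
      rw [hJb]
      ring
    have hJ' : Tendsto (fun δ : ℝ =>
        (-(∫ x, (pinnedChain ω₂ lam β γ).bondCurrent N ⟨b, hbN⟩ x ∂(μ N (T + δ / 2) (T - δ / 2))) / T ^ 2) / δ)
        (𝓝[≠] 0) (𝓝 (-(D N / ((N : ℝ) - 1)) / T ^ 2)) := by
      have h2 := (hJ.neg).div_const (T ^ 2)
      refine h2.congr fun δ => ?_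
      ring
    have hlim := tendsto_nhds_unique hJ' hDU'
    have hGE : D N / ((N : ℝ) - 1) = γ / 2 * ∫ x, U x * (∑ i : Fin N, ((if i.val = 0 then x.2 i ^ 2 else 0) - (if i.val = N - 1 then x.2 i ^ 2 else 0))) ∂((pinnedChain ω₂ lam β γ).gibbsMeasure N T) := by
      have h3 : D N / ((N : ℝ) - 1) = -(-(D N / ((N : ℝ) - 1)) / T ^ 2) * T ^ 2 := by
        field_simp
      rw [h3, hlim]
      field_simp
    ------------------------------------------------------------------
    -- `K`-side: `k ≤ K` for every admissible `K`
    ------------------------------------------------------------------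
    -- stub 3 with `F = Z`: the response of `φ = U - U∘Θ`
    have hDZ := hDual' Z hZs hZb
    have hm : Tendsto (fun δ : ℝ =>
        (∫ x, (U x - U (x.1, -x.2)) ∂(μ N (T + δ / 2) (T - δ / 2))) / δ)
        (𝓝[≠] 0) (𝓝 (-(γ / (2 * T ^ 2)) * ∫ x, Z x * (∑ i : Fin N, ((if i.val = 0 then x.2 i ^ 2 else 0) - (if i.val = N - 1 then x.2 i ^ 2 else 0))) ∂((pinnedChain ω₂ lam β γ).gibbsMeasure N T))) := by
      refine hDZ.congr fun δ => ?_
      rw [integral_congr_ae (ae_of_all _ hZeq)]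
    -- stub 4 (a) with `F = φ²` (weight `e^{2θH}`, `2θ < 1/T`)
    have hUc : Continuous U := hUs.continuous
    have hφc : Continuous fun x : PhaseSpace N => U x - U (x.1, -x.2) := by fun_prop
    have hφ2c : Continuous fun x : PhaseSpace N => (U x - U (x.1, -x.2)) ^ 2 := by fun_prop
    have hθ2 : 2 * θ < 1 / T := by
      have h := mul_lt_mul_of_pos_left hθ (by norm_num : (0 : ℝ) < 2)
      have h' : (2 : ℝ) * (1 / (2 * T)) = 1 / T := by field_simp
      linarith [h, h']
    have hU0 : ∀ x : PhaseSpace N, |U x| ≤ A * Real.exp (θ * (pinnedChain ω₂ lam β γ).hamiltonian N x) := by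
      intro x
      have h := (hbd 0 (by norm_num) x).1
      rwa [norm_iteratedFDeriv_zero, Real.norm_eq_abs] at h
    have hφbd : ∃ A' : ℝ, ∀ x : PhaseSpace N,
        |(U x - U (x.1, -x.2)) ^ 2| ≤ A' * Real.exp (2 * θ * (pinnedChain ω₂ lam β γ).hamiltonian N x) := by
      refine ⟨(2 * A) ^ 2, fun x => ?_⟩
      have h1 := hU0 x
      have h2 := hU0 (x.1, -x.2)
      rw [OscillatorChain.hamiltonian_neg_momentum] at h2
      have h3 : |U x - U (x.1, -x.2)| ≤ 2 * A * Real.exp (θ * (pinnedChain ω₂ lam β γ).hamiltonian N x) := by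
        have := abs_sub (U x) (U (x.1, -x.2))
        linarith
      have h4 : |U x - U (x.1, -x.2)| ^ 2 ≤ (2 * A * Real.exp (θ * (pinnedChain ω₂ lam β γ).hamiltonian N x)) ^ 2 :=
        pow_le_pow_left₀ (abs_nonneg _) h3 2
      have h5 : (2 * A * Real.exp (θ * (pinnedChain ω₂ lam β γ).hamiltonian N x)) ^ 2 =
          (2 * A) ^ 2 * Real.exp (2 * θ * (pinnedChain ω₂ lam β γ).hamiltonian N x) := by
        rw [mul_pow, sq (Real.exp _), ← Real.exp_add]
        ring_nf
      rw [abs_pow, ← h5]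
      exact h4
    obtain ⟨hInt, hs⟩ := hStat (2 * θ) hθ2 _ hφ2c hφbd
    -- stub 5 at each small `δ`
    have hφodd : ∀ x : PhaseSpace N,
        (fun y : PhaseSpace N => U y - U (y.1, -y.2)) (x.1, -x.2) =
          -(fun y : PhaseSpace N => U y - U (y.1, -y.2)) x := by
      intro x
      simp only [neg_neg, Prod.mk.eta]
      ring
    have hCSδ : ∀ᶠ δ in 𝓝[≠] (0 : ℝ),
        InformationTheory.klDiv (μ N (T + δ / 2) (T - δ / 2))
            (Measure.map (fun x : PhaseSpace N => (x.1, -x.2)) (μ N (T + δ / 2) (T - δ / 2))) ≠ ⊤ →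
          (∫ x, (U x - U (x.1, -x.2)) ∂(μ N (T + δ / 2) (T - δ / 2))) ^ 2 ≤
            (1 / 2) * (InformationTheory.klDiv (μ N (T + δ / 2) (T - δ / 2))
              (Measure.map (fun x : PhaseSpace N => (x.1, -x.2)) (μ N (T + δ / 2) (T - δ / 2)))).toReal *
              ∫ x, (U x - U (x.1, -x.2)) ^ 2 ∂(μ N (T + δ / 2) (T - δ / 2)) := by
      filter_upwards [hInt, hpos] with δ hI hδ
      intro hne
      have hprob : IsProbabilityMeasure (μ N (T + δ / 2) (T - δ / 2)) := (hμ N _ _ hδ.1 hδ.2).1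
      have hmem : MemLp (fun x : PhaseSpace N => U x - U (x.1, -x.2)) 2 (μ N (T + δ / 2) (T - δ / 2)) :=
        (memLp_two_iff_integrable_sq hφc.aestronglyMeasurable).2 hI
      exact hOdd N (μ N (T + δ / 2) (T - δ / 2)) hprob (fun y : PhaseSpace N => U y - U (y.1, -y.2)) hφodd hmem hne
    ------------------------------------------------------------------
    -- assembly for this bond
    ------------------------------------------------------------------
    refine ⟨_, hg0, hGE.trans hcalU, ?_⟩
    intro t ht K hK hev
    obtain ⟨hV0, hineq⟩ := hdyn t ht
    have hk : (1 / 2) * ∫ x, (U x - U (x.1, -x.2)) ^ 2 ∂((pinnedChain ω₂ lam β γ).gibbsMeasure N T) ≤ K := by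
      have h := half_le_of_levers (KLδ := fun δ : ℝ =>
          InformationTheory.klDiv (μ N (T + δ / 2) (T - δ / 2))
            (Measure.map (fun x : PhaseSpace N => (x.1, -x.2)) (μ N (T + δ / 2) (T - δ / 2))))
        hK hCSδ (fun δ => integral_nonneg fun x => sq_nonneg _) hm hs hev
        (by rw [hcalZ]; ring)
      linarith [h]
    refine hineq.trans ?_
    exact mul_le_mul_of_nonneg_left (by linarith [hk]) hV0
  refine ⟨?_, ?_⟩
  · obtain ⟨g, hg0, hG, -⟩ := key 0 (by omega)
    have : D N = g * ((N : ℝ) - 1) := (div_eq_iff hN1.ne').mp hG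
    rw [this]
    exact mul_nonneg hg0 hN1.le
  · intro b hb t ht K hK hev
    obtain ⟨g, hg0, hG, hb'⟩ := key b hb
    rw [hG]
    exact hb' t ht K hK hev

/-- Wiring check: the six registered stubs feed `LinearResponseFTUR_of` exactly as stated (their verbatim statements
are definitionally the `Registered.*` aliases). An `example`, so that `LinearResponseFTUR_of` stays the only theorem of
the file concluding the crux. -/
example : Summit.AtomisticToContinuum.FouriersLaw.Theses.BondHeatUncertainty.LinearResponseFTUR :=
  LinearResponseFTUR_of stub_correctors stub_scoreCauchySchwarz stub_dualResponse stub_nearEquilibrium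
    stub_oddSnapshotBound stub_gibbsDetailedBalance

end Summit.AtomisticToContinuum.FouriersLaw.Cruxes.LinearResponseFTUR.LinearScoreCauchySchwarz
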